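import Summits.QuantumFields.YangMills.Theorems.UnitScaleTiltProp7TowerClosenessStairs
import Summits.QuantumFields.YangMills.Theorems.UnitScaleTiltProp7SymFrameUnitary
import HarnessLib

/-!
# Route `UnitScaleTilt`, crux K1 child «MinimiserStabilityRegPr» (stmt-QuantumFields-19200), skeleton v10, stub `stub_existenceMinimalOrbit` (EX), route (α) —
# **THE TOWER-CLOSENESS ROWS OF T5 FROM `RegPr`, PART 2∕2: THE FRAMES (`hν hν' hw`) AND THE GAUGE-INVARIANT LOOPS (`hH hH'`).**  Sibling of ✓`…Prop7TowerClosenessStairs` (PART 1: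
# stair letters, `hτ`).  Setting: printed-regular background `U₀ ∈ 𝔘_k(ε₀)`, chart point `U′ = e^{A₁}U₀`, `‖A₁‖ < e·η`, windows `10¹²L³ε₀ ≤ 1`, `10⁹L²e ≤ 1` ONLY — no regularity of
# `U′` is used (★px11 g0's reading (G2), adopted by the namer ★w5-20520 g6 16:33Z): T5's loop `H_{j,y,i}` is the conjugate by the special unitary frame `ν_j(ŷ)` of
# `τ_j(y,i)·ι(Ū₀ʲ(Γ_i)Ū₀ʲ(Γ_ref)⁻¹)·τ_j(y,(i.1,1,1))⁻¹`, so only the BACKGROUND tower's plaquettes enter.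

Cell `ym3-torus`, width seat `ym3-torus-px6` (gen 0).  THEOREMS ONLY (0 `def`, 0 `sorry`).  `--supports stmt-QuantumFields-19200 --as helper`, count-neutral.
YM₃ on T³ is a ladder rung (R3), not the Clay problem; nothing here claims the stub, the crux, d = 4 or the mass gap.

WHAT IS PROVED (sorry-free, no definition; T³ member, `d = 3`, pair `(bgUnits F K U₀, bgUnits F K U′)`).
* ★★`frameAccU_bgUnits_mem_specialUnitaryGroup_of_regPr` — every accumulated frame `ν_j(x) = frameAccU j U₀♭ U′♭ x ∈ SU(2)`, `j ≤ K − n` (✓`frameAccU_mem_specialUnitaryGroup_of_plaqSmall`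
  at `k := j` with W2's budgets at level `j` bounded by those at level `K − n`: `Lʲt ≤ e`, `Lʲs_B ≤ 18ε₀`; `e^{A₁(b)} = U′(b)U₀(b)⁻¹ ∈ SU(2)` automatically) ⇒ **ROWS `hν`, `hν'`**
  (`norm_frameAccU_le_two_of_regPr`, `norm_frameAccU_inv_le_two_of_regPr`) and **ROW `hw`** (`norm_vframeCovU_inv_le_two_of_regPr`: `w_j(y) = ν_j(ŷ)⁻¹ν_{j+1}(y)` by (97)).
* `loop_budget` + `dist1_stair_loop_iter_le_of_regPr` — the `SU(2)` two-staircase loops `Ū₀ʲ(Γ_σ)Ū₀ʲ(Γ_τ)⁻¹` of the BACKGROUND tower are within `10⁻⁶` of `1` (plaquettes of `Ū₀ʲ`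
  within `(10800L+1)L^{2j}ε₀L^{−2(K−n)}` of `1` by ✓`plaqSmall_iter_T3_allL`, `≤ (3(L−1)∕2)²` of them by PART 1's Stokes bound; `(9∕4)L²(10800L+1)ε₀ ≤ 2.5·10⁻⁸`);
  `holT_dbar_eq_tstairU_mul` (`D̄_j(Γ) = τ·Ū₀♭ʲ(Γ)`, ✓`tstairU_def`); ★`loopH_eq_conj_of_regPr` — T5's `Q_{y,i}Q_{y,(i.1,1,1)}⁻¹Q_{y,(r_c,1,1)}` IS
  `ν_j(ŷ)·(τ_j(y,i)·ι(Ū₀ʲ(Γ_i)Ū₀ʲ(Γ_ref)⁻¹)·τ_j(y,(i.1,1,1))⁻¹)·ν_j(ŷ)⁻¹` (both staircases end at the same site, the centre factor is the empty word);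
  whence **ROWS `hH`, `hH'`** ★★`norm_loopH_sub_one_le_of_regPr` ∕ ★★`norm_loopH_inv_sub_one_le_of_regPr` (`≤ 4·10⁻⁶ + 2·10⁻⁶ ≤ 1∕200` by PART 1's `norm_conj_triple_sub_one_le`,
  `norm_tstairU_sub_one_le_of_regPr`).
HONEST SCOPE.  Compositions of landed letters with explicit numerals; the rows are exactly T5's displayed hypotheses (T5 A∕B are NOT imported here; the corollary «(P1) at the chart point
with no closeness display» is a separate file once T5 B lands); nothing of print is asserted beyond the cited bookkeeping; (P2) and the 𝔰𝔲(2)-reality of T5's output are untouched.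

References: T. Bałaban, CMP **98** (1985) 17–51 [Balaban1985Averaging] ((8)–(9), (11) pp.18–19, (19)–(20) p.21, (58) p.27, (82) p.30, (97) p.32, Prop. 4 p.38, (161)–(163) p.42);
CMP **102** (1985) 277–309 [Balaban1985Variational] ((2) p.278, (44) p.285, (146) p.301); CMP **109** (1987) 249–301 [Balaban1987RG1] ((0.3)–(0.4) pp.252–253, (0.9)–(0.11) p.253).
-/

set_option autoImplicit false

noncomputable section

open scoped Matrix.Norms.L2Operator
open Filter Topology Metric

namespace Summit.QuantumFields.YangMills.Theorems.Prop7TowerClosenessOfRegPr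

open NormedSpace
open Literature.MathematicalPhysics.QuantumFieldTheory.Balaban1983to89
open T4Continuum T4ReflectionCone BlockAveraging AveragingRT ExpMeanLog MatrixLog LatticeFieldCalculus
open FederbushMean (dist1_SU_eq)
open B10Eq27TorusAxialLog (holT holT_nil holT_cons_true holT_cons_false holT_append holT_map holT_eq_holAt gaugeActT gaugeActT_apply transl transl_apply
  unitsField toUField suIncl val_suIncl)
open B7Prop1Explicit (expUnit val_expUnit U1 mem_U1 disp disp_nil disp_cons)
open B7Prop2SpecialUnitary (specialUnitaryUnits mem_specialUnitaryUnits specialUnitaryUnits_le_U1)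
open T3ContinuumYM3Torus
open T3RegularMinimiser (regThreshold)
open T3PrintedRegularMinimiser (RegPr)
open T3SectALandauChart (eta eta_pos bgUnits)
open Summit.QuantumFields.YangMills.Theorems.Prop8Chart (emlIterU emlIterU_succ holT_gaugeActT)
open Summit.QuantumFields.YangMills.Theorems.Prop7SymAvgTwSym (tstairU tstairU_def vframeCovU dbarCovIterU frameAccU frameAccU_succ dbarCovIterU_eq_gaugeActT_frameAccU
  norm_tstairU_sub_one_le_of_rel norm_sub_le_of_rel norm_inv_sub_inv_le_of_rel emlIterU_bgUnits_mem_U1_of_regPr norm_dbarCovIterU_rel_sub_one_le_of_regPr)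
open Summit.QuantumFields.YangMills.Theorems.Prop7SymAvgGLSmallOfRegPr (coe_iter_eq_emlIterU_of_regPr bgUnits_eq)
open Summit.QuantumFields.YangMills.Theorems.IterPlaqSmallAllL (plaqSmall_iter_T3_allL)
open Summit.QuantumFields.YangMills.Theorems.Prop7SymFrameBound (frameAccU_mem_specialUnitaryGroup_of_plaqSmall hstep_of_W1 hframe_of_W1)


/-! ## §3 (continued) The T³ member: frames and loops -/

section T3

variable (F : T3Family) {n K : ℕ}

set_option maxHeartbeats 400000 in
/-- ★★ **EVERY ACCUMULATED FRAME OF THE PAIR `(U₀♭, U′♭)` IS SPECIAL UNITARY**: at `U₀ ∈ 𝔘_k(ε₀)` (`10¹²L³ε₀ ≤ 1`), chart point `U′ = e^{A₁}U₀` (`‖A₁‖ < e·η`, `10⁹L²e ≤ 1`),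
for every `j ≤ K − n` and every site `x` of `T^{(j)}`: `ν_j(x) = frameAccU j U₀♭ U′♭ x ∈ SU(2)` — ✓`frameAccU_mem_specialUnitaryGroup_of_plaqSmall` at `k := j` with W2's budgets
at level `j` (`Lʲ·t ≤ e`, `Lʲ·s_B ≤ 18ε₀`; the `SU(2)`-valuedness of `e^{A₁(b)} = U′(b)U₀(b)⁻¹` is automatic). [cite: Balaban1985Averaging, (97) p.32, Prop. 4 p.38; Balaban1985Variational, (2) p.278] -/
theorem frameAccU_bgUnits_mem_specialUnitaryGroup_of_regPr {ε₀ e : ℝ} (hε₀ : 0 < ε₀) (he : 0 < e) (hWe : 10 ^ 9 * (F.L : ℝ) ^ 2 * e ≤ 1)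
    (hWε : 10 ^ 12 * (F.L : ℝ) ^ 3 * ε₀ ≤ 1)
    (U₀ U' : GaugeField (F.P K) 0 (Matrix.specialUnitaryGroup (Fin 2) ℂ)) (hreg : RegPr F n K ε₀ U₀)
    (A₁ : PBond (F.P K) 0 → Matrix (Fin 2) (Fin 2) ℂ) (hA₁ : ‖A₁‖ < e * eta F n K)
    (hU' : ∀ b, ((U' b : Matrix.specialUnitaryGroup (Fin 2) ℂ) : Matrix (Fin 2) (Fin 2) ℂ) = exp (A₁ b) * ((U₀ b : Matrix.specialUnitaryGroup (Fin 2) ℂ) : Matrix (Fin 2) (Fin 2) ℂ))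
    {j : ℕ} (hj : j ≤ K - n) (x : Site (F.P K) j) :
    ((frameAccU j (bgUnits F K U₀) (bgUnits F K U') x : (Matrix (Fin 2) (Fin 2) ℂ)ˣ) : Matrix (Fin 2) (Fin 2) ℂ) ∈ Matrix.specialUnitaryGroup (Fin 2) ℂ := by
  have hd : (F.P K).d = 3 := T3Family.P_d F K
  have hLn : (F.P K).L = F.L := rfl
  have hL3 : 3 ≤ F.L := by obtain ⟨a, ha⟩ := F.hL.1; have := F.hL.2; omega
  have hL3r : (3 : ℝ) ≤ F.L := by exact_mod_cast hL3
  have hL0 : (0 : ℝ) < F.L := by linarith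
  have hL1 : (1 : ℝ) ≤ F.L := by linarith
  have hk1 : j + 1 ≤ (F.P K).m + (F.P K).K := by
    show j + 1 ≤ F.m + K; have := F.hm; omega
  -- level letters: `Xp := Lʲ ≤ L^{K−n} =: Xk`, `Xk·η = 1`, `Xk²·a₀ = ε₀`
  set Xp : ℝ := (F.L : ℝ) ^ j with hXp
  set Xk : ℝ := (F.L : ℝ) ^ (K - n) with hXk
  have hX1 : 1 ≤ Xp := one_le_pow₀ hL1
  have hX0 : 0 < Xp := by positivity
  have hXk0 : 0 < Xk := by positivity
  have hXle : Xp ≤ Xk := pow_le_pow_right₀ hL1 hj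
  have hXη : Xk * eta F n K = 1 := by
    show (F.L : ℝ) ^ (K - n) * ((F.L : ℝ)⁻¹) ^ (K - n) = 1
    rw [inv_pow, mul_inv_cancel₀ (pow_ne_zero _ hL0.ne')]
  have hη0 : 0 < eta F n K := eta_pos F n K
  set a₀ : ℝ := regThreshold F n K ε₀ with ha₀
  have ha₀0 : 0 < a₀ := by rw [ha₀]; unfold regThreshold; positivity
  have hXa : Xk * (Xk * a₀) = ε₀ := by
    have hX2 : Xk * Xk = (F.L : ℝ) ^ (2 * (K - n)) := by rw [hXk, ← pow_add, two_mul]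
    have ha : a₀ = ε₀ * ((F.L : ℝ) ^ (2 * (K - n)))⁻¹ := by rw [ha₀]; unfold regThreshold; rw [inv_pow]
    rw [← mul_assoc, hX2, ha, mul_comm ε₀, ← mul_assoc, mul_inv_cancel₀ (pow_ne_zero _ hL0.ne'), one_mul]
  have hU : PlaqSmall a₀ U₀ := hreg.1
  set t : ℝ := e * eta F n K with ht
  have ht0 : 0 ≤ t := by positivity
  have hXt : Xp * t ≤ e := by
    have h1 : Xp * t ≤ Xk * t := mul_le_mul_of_nonneg_right hXle ht0
    have h2 : Xk * t = e := by rw [ht, mul_left_comm, hXη, mul_one]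
    linarith
  have hXt0 : 0 ≤ Xp * t := by positivity
  have he1 : e ≤ 1 := by nlinarith [mul_nonneg (by norm_num : (0 : ℝ) ≤ 10 ^ 9) (mul_nonneg (sq_nonneg (F.L : ℝ)) he.le)]
  have ht1 : t ≤ 1 := by nlinarith
  have hA₁b : ∀ b, ‖A₁ b‖ ≤ t := fun b => (norm_le_pi_norm A₁ b).trans hA₁.le
  set sB : ℝ := 2 * (((3 : ℕ) : ℝ) * (3 * Xp - 1)) * a₀ with hsB
  have hsB0 : 0 ≤ sB := by
    rw [hsB]; have : (0 : ℝ) ≤ 3 * Xp - 1 := by linarith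
    positivity
  have hXsB : Xp * sB ≤ 18 * ε₀ := by
    have h1 : Xp * sB ≤ 18 * (Xp * (Xp * a₀)) := by
      rw [hsB]; push_cast; nlinarith [mul_nonneg hX0.le ha₀0.le]
    have h2 : Xp * (Xp * a₀) ≤ Xk * (Xk * a₀) := by
      have := mul_le_mul hXle (mul_le_mul_of_nonneg_right hXle ha₀0.le) (by positivity) hXk0.le
      exact this
    linarith
  have hXsB0 : 0 ≤ Xp * sB := mul_nonneg hX0.le hsB0
  have hℓ : ((((3 : ℕ) + 2) * F.L : ℕ) : ℝ) = 5 * F.L := by push_cast; ring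
  have hε' : (F.L : ℝ) ^ 3 * ε₀ ≤ 1 / 10 ^ 12 := by
    rw [le_div_iff₀ (by positivity)]; linarith
  have he' : (F.L : ℝ) ^ 2 * e ≤ 1 / 10 ^ 9 := by
    rw [le_div_iff₀ (by positivity)]; linarith
  have hL23 : (F.L : ℝ) ^ 2 ≤ (F.L : ℝ) ^ 3 := pow_le_pow_right₀ hL1 (by norm_num)
  have hL12 : (F.L : ℝ) ≤ (F.L : ℝ) ^ 2 := by nlinarith
  have hL2ε : (F.L : ℝ) ^ 2 * ε₀ ≤ (F.L : ℝ) ^ 3 * ε₀ := mul_le_mul_of_nonneg_right hL23 hε₀.le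
  have hLε : (F.L : ℝ) * ε₀ ≤ (F.L : ℝ) ^ 2 * ε₀ := mul_le_mul_of_nonneg_right hL12 hε₀.le
  have hLe : (F.L : ℝ) * e ≤ (F.L : ℝ) ^ 2 * e := mul_le_mul_of_nonneg_right hL12 he.le
  have hbud₀ : 6400 * ((((3 : ℕ) + 2) * F.L : ℕ) : ℝ) ^ 2 * Xp * sB ≤ 1 := by
    rw [hℓ]
    have : 6400 * (5 * (F.L : ℝ)) ^ 2 * Xp * sB = 160000 * (F.L : ℝ) ^ 2 * (Xp * sB) := by ring
    rw [this]; nlinarith [sq_nonneg (F.L : ℝ)]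
  have hbud : 8 * (16 * (22100 : ℝ) + 2) * ((((3 : ℕ) + 2) * F.L : ℕ) : ℝ) ^ 2 * (Xp * (2 * t + 30 * ((((3 : ℕ) + 2) * F.L : ℕ) : ℝ) * sB)) ≤ 1 := by
    rw [hℓ]
    have : 8 * (16 * (22100 : ℝ) + 2) * (5 * (F.L : ℝ)) ^ 2 * (Xp * (2 * t + 30 * (5 * (F.L : ℝ)) * sB)) =
        141440800 * (F.L : ℝ) ^ 2 * (Xp * t) + 10608060000 * (F.L : ℝ) ^ 3 * (Xp * sB) := by ring
    rw [this]
    have h1 : (F.L : ℝ) ^ 2 * (Xp * t) ≤ (F.L : ℝ) ^ 2 * e := mul_le_mul_of_nonneg_left hXt (by positivity)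
    have h2 : (F.L : ℝ) ^ 3 * (Xp * sB) ≤ (F.L : ℝ) ^ 3 * (18 * ε₀) := mul_le_mul_of_nonneg_left hXsB (by positivity)
    nlinarith [pow_nonneg hL0.le 3]
  have hρ : 48 * ((((3 : ℕ) + 2) * F.L : ℕ) : ℝ) *
      (2 * (Xp * (2 * t + 30 * ((((3 : ℕ) + 2) * F.L : ℕ) : ℝ) * sB)) + 30 * ((((3 : ℕ) + 2) * F.L : ℕ) : ℝ) * Xp * sB) ≤ 1 := by
    rw [hℓ]
    have : 48 * (5 * (F.L : ℝ)) * (2 * (Xp * (2 * t + 30 * (5 * (F.L : ℝ)) * sB)) + 30 * (5 * (F.L : ℝ)) * Xp * sB) =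
        960 * (F.L : ℝ) * (Xp * t) + 108000 * (F.L : ℝ) ^ 2 * (Xp * sB) := by ring
    rw [this]
    have h1 : (F.L : ℝ) * (Xp * t) ≤ (F.L : ℝ) * e := mul_le_mul_of_nonneg_left hXt hL0.le
    have h2 : (F.L : ℝ) ^ 2 * (Xp * sB) ≤ (F.L : ℝ) ^ 2 * (18 * ε₀) := mul_le_mul_of_nonneg_left hXsB (by positivity)
    nlinarith [sq_nonneg (F.L : ℝ)]
  have hW : (fun b => expUnit (A₁ b) * unitsField (toUField U₀) b) = bgUnits F K U' := by
    rw [bgUnits_eq_expUnit_mul F U₀ U' A₁ hU']; rfl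
  have h2 := frameAccU_mem_specialUnitaryGroup_of_plaqSmall (P := F.P K) (C₁ := 22100) (by norm_num) hstep_of_W1 hframe_of_W1 hk1 U₀ ha₀0 hU
    A₁ ht0 ht1 hA₁b (coe_expUnit_mem_specialUnitaryGroup_of_chart F U₀ U' A₁ hU')
    (by rw [hd, hLn, ← hXp, ← hsB]; exact hbud₀) (by rw [hd, hLn, ← hXp, ← hsB]; exact hbud) (by rw [hd, hLn, ← hXp, ← hsB]; exact hρ) x
  rw [hW] at h2
  exact h2

/-- **ROW `hν` FROM `RegPr`**: `‖ν_j(x)‖ ≤ 2` for `j < K − n` (the frame is special unitary, so its operator norm is `≤ 1`). [cite: Balaban1985Averaging, (97) p.32, (19) p.21] -/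
theorem norm_frameAccU_le_two_of_regPr {ε₀ e : ℝ} (hε₀ : 0 < ε₀) (he : 0 < e) (hWe : 10 ^ 9 * (F.L : ℝ) ^ 2 * e ≤ 1) (hWε : 10 ^ 12 * (F.L : ℝ) ^ 3 * ε₀ ≤ 1)
    (U₀ U' : GaugeField (F.P K) 0 (Matrix.specialUnitaryGroup (Fin 2) ℂ)) (hreg : RegPr F n K ε₀ U₀)
    (A₁ : PBond (F.P K) 0 → Matrix (Fin 2) (Fin 2) ℂ) (hA₁ : ‖A₁‖ < e * eta F n K)
    (hU' : ∀ b, ((U' b : Matrix.specialUnitaryGroup (Fin 2) ℂ) : Matrix (Fin 2) (Fin 2) ℂ) = exp (A₁ b) * ((U₀ b : Matrix.specialUnitaryGroup (Fin 2) ℂ) : Matrix (Fin 2) (Fin 2) ℂ)) :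
    ∀ (j : ℕ) (x : Site (F.P K) j), j < K - n →
      ‖((frameAccU j (bgUnits F K U₀) (bgUnits F K U') x : (Matrix (Fin 2) (Fin 2) ℂ)ˣ) : Matrix (Fin 2) (Fin 2) ℂ)‖ ≤ 2 := by
  intro j x hj
  have hsu : frameAccU j (bgUnits F K U₀) (bgUnits F K U') x ∈ specialUnitaryUnits (Fin 2) := by
    rw [mem_specialUnitaryUnits]
    exact frameAccU_bgUnits_mem_specialUnitaryGroup_of_regPr F hε₀ he hWe hWε U₀ U' hreg A₁ hA₁ hU' hj.le x
  exact (mem_U1.1 (specialUnitaryUnits_le_U1 hsu)).1.trans (by norm_num)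

/-- **ROW `hν'` FROM `RegPr`**: `‖ν_j(x)⁻¹‖ ≤ 2` for `j < K − n`. [cite: Balaban1985Averaging, (97) p.32, (19) p.21] -/
theorem norm_frameAccU_inv_le_two_of_regPr {ε₀ e : ℝ} (hε₀ : 0 < ε₀) (he : 0 < e) (hWe : 10 ^ 9 * (F.L : ℝ) ^ 2 * e ≤ 1) (hWε : 10 ^ 12 * (F.L : ℝ) ^ 3 * ε₀ ≤ 1)
    (U₀ U' : GaugeField (F.P K) 0 (Matrix.specialUnitaryGroup (Fin 2) ℂ)) (hreg : RegPr F n K ε₀ U₀)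
    (A₁ : PBond (F.P K) 0 → Matrix (Fin 2) (Fin 2) ℂ) (hA₁ : ‖A₁‖ < e * eta F n K)
    (hU' : ∀ b, ((U' b : Matrix.specialUnitaryGroup (Fin 2) ℂ) : Matrix (Fin 2) (Fin 2) ℂ) = exp (A₁ b) * ((U₀ b : Matrix.specialUnitaryGroup (Fin 2) ℂ) : Matrix (Fin 2) (Fin 2) ℂ)) :
    ∀ (j : ℕ) (x : Site (F.P K) j), j < K - n →
      ‖(((frameAccU j (bgUnits F K U₀) (bgUnits F K U') x)⁻¹ : (Matrix (Fin 2) (Fin 2) ℂ)ˣ) : Matrix (Fin 2) (Fin 2) ℂ)‖ ≤ 2 := by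
  intro j x hj
  have hsu : frameAccU j (bgUnits F K U₀) (bgUnits F K U') x ∈ specialUnitaryUnits (Fin 2) := by
    rw [mem_specialUnitaryUnits]
    exact frameAccU_bgUnits_mem_specialUnitaryGroup_of_regPr F hε₀ he hWe hWε U₀ U' hreg A₁ hA₁ hU' hj.le x
  exact (mem_U1.1 (specialUnitaryUnits_le_U1 hsu)).2.trans (by norm_num)

/-- **ROW `hw` FROM `RegPr`**: `‖w_j(y)⁻¹‖ ≤ 2` for the one-level covariant frame `w_j(y) = vframeCovU (Ū₀♭ʲ) (D̄_j) y` at `j < K − n` — by (97) `w_j(y) = ν_j(ŷ)⁻¹·ν_{j+1}(y)`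
(✓`frameAccU_succ`), a quotient of two special unitary frames. [cite: Balaban1985Averaging, (97) p.32, (82) p.30] -/
theorem norm_vframeCovU_inv_le_two_of_regPr {ε₀ e : ℝ} (hε₀ : 0 < ε₀) (he : 0 < e) (hWe : 10 ^ 9 * (F.L : ℝ) ^ 2 * e ≤ 1) (hWε : 10 ^ 12 * (F.L : ℝ) ^ 3 * ε₀ ≤ 1)
    (U₀ U' : GaugeField (F.P K) 0 (Matrix.specialUnitaryGroup (Fin 2) ℂ)) (hreg : RegPr F n K ε₀ U₀)
    (A₁ : PBond (F.P K) 0 → Matrix (Fin 2) (Fin 2) ℂ) (hA₁ : ‖A₁‖ < e * eta F n K)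
    (hU' : ∀ b, ((U' b : Matrix.specialUnitaryGroup (Fin 2) ℂ) : Matrix (Fin 2) (Fin 2) ℂ) = exp (A₁ b) * ((U₀ b : Matrix.specialUnitaryGroup (Fin 2) ℂ) : Matrix (Fin 2) (Fin 2) ℂ)) :
    ∀ (j : ℕ) (y : Site (F.P K) (j + 1)), j < K - n →
      ‖(((vframeCovU (emlIterU j (bgUnits F K U₀)) (dbarCovIterU j (bgUnits F K U₀) (bgUnits F K U')) y)⁻¹ : (Matrix (Fin 2) (Fin 2) ℂ)ˣ) : Matrix (Fin 2) (Fin 2) ℂ)‖ ≤ 2 := by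
  intro j y hj
  have hj1 : j + 1 ≤ K - n := hj
  have hν : frameAccU j (bgUnits F K U₀) (bgUnits F K U') (emb y) ∈ specialUnitaryUnits (Fin 2) := by
    rw [mem_specialUnitaryUnits]
    exact frameAccU_bgUnits_mem_specialUnitaryGroup_of_regPr F hε₀ he hWe hWε U₀ U' hreg A₁ hA₁ hU' hj.le (emb y)
  have hν1 : frameAccU (j + 1) (bgUnits F K U₀) (bgUnits F K U') y ∈ specialUnitaryUnits (Fin 2) := by
    rw [mem_specialUnitaryUnits]
    exact frameAccU_bgUnits_mem_specialUnitaryGroup_of_regPr F hε₀ he hWe hWε U₀ U' hreg A₁ hA₁ hU' hj1 y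
  have hw : vframeCovU (emlIterU j (bgUnits F K U₀)) (dbarCovIterU j (bgUnits F K U₀) (bgUnits F K U')) y =
      (frameAccU j (bgUnits F K U₀) (bgUnits F K U') (emb y))⁻¹ * frameAccU (j + 1) (bgUnits F K U₀) (bgUnits F K U') y := by
    rw [frameAccU_succ, inv_mul_cancel_left]
  have hsu : vframeCovU (emlIterU j (bgUnits F K U₀)) (dbarCovIterU j (bgUnits F K U₀) (bgUnits F K U')) y ∈ specialUnitaryUnits (Fin 2) := by
    rw [hw]; exact Subgroup.mul_mem _ (Subgroup.inv_mem _ hν) hν1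
  exact (mem_U1.1 (specialUnitaryUnits_le_U1 hsu)).2.trans (by norm_num)

/-- the numerics of the loop rows: `(3·((L−1)∕2))²·((10800L+1)·(L^{2j}·ε₀L^{−2(K−n)})) ≤ 10⁻⁶` for `j ≤ K − n`, `10¹²L³ε₀ ≤ 1`. [cite: Balaban1985Variational, (146) p.301] -/
theorem loop_budget {ε₀ : ℝ} (hε₀ : 0 < ε₀) (hWε : 10 ^ 12 * (F.L : ℝ) ^ 3 * ε₀ ≤ 1) {j : ℕ} (hj : j ≤ K - n) :
    (((F.P K).d : ℝ) * (((F.P K).L - 1) / 2 : ℕ)) ^ 2 * ((10800 * (F.L : ℝ) + 1) * ((F.L : ℝ) ^ (2 * j) * regThreshold F n K ε₀)) ≤ 1 / 10 ^ 6 := by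
  have hd : (F.P K).d = 3 := T3Family.P_d F K
  have hLn : (F.P K).L = F.L := rfl
  have hL3 : 3 ≤ F.L := by obtain ⟨a, ha⟩ := F.hL.1; have := F.hL.2; omega
  have hL3r : (3 : ℝ) ≤ F.L := by exact_mod_cast hL3
  have hL0 : (0 : ℝ) < F.L := by linarith
  set X : ℝ := (F.L : ℝ) ^ (2 * j) * regThreshold F n K ε₀ with hX
  have hX0 : 0 ≤ X := by rw [hX]; unfold regThreshold; positivity
  have hXε : X ≤ ε₀ := by
    rw [hX]
    unfold regThreshold
    have hle : (F.L : ℝ) ^ (2 * j) ≤ (F.L : ℝ) ^ (2 * (K - n)) := pow_le_pow_right₀ (by linarith) (by omega)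
    have hpos : (0 : ℝ) < (F.L : ℝ) ^ (2 * (K - n)) := by positivity
    rw [inv_pow, show (F.L : ℝ) ^ (2 * j) * (ε₀ * ((F.L : ℝ) ^ (2 * (K - n)))⁻¹) = ε₀ * ((F.L : ℝ) ^ (2 * j) / (F.L : ℝ) ^ (2 * (K - n))) by ring]
    calc ε₀ * ((F.L : ℝ) ^ (2 * j) / (F.L : ℝ) ^ (2 * (K - n))) ≤ ε₀ * 1 :=
          mul_le_mul_of_nonneg_left ((div_le_one hpos).2 hle) hε₀.le
      _ = ε₀ := mul_one _
  have hhalf : ((((F.P K).L - 1) / 2 : ℕ) : ℝ) ≤ (F.L : ℝ) / 2 := by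
    have h1 : 2 * (((F.P K).L - 1) / 2) ≤ F.L := by rw [hLn]; omega
    have h2 : ((2 * (((F.P K).L - 1) / 2) : ℕ) : ℝ) ≤ (F.L : ℝ) := by exact_mod_cast h1
    push_cast at h2
    linarith
  have hh0 : (0 : ℝ) ≤ ((((F.P K).L - 1) / 2 : ℕ) : ℝ) := Nat.cast_nonneg _
  rw [hd]
  push_cast
  have hsq : ((3 : ℝ) * ((((F.P K).L - 1) / 2 : ℕ) : ℝ)) ^ 2 ≤ 9 / 4 * (F.L : ℝ) ^ 2 := by nlinarith
  have h1 : ((3 : ℝ) * ((((F.P K).L - 1) / 2 : ℕ) : ℝ)) ^ 2 * ((10800 * (F.L : ℝ) + 1) * X) ≤ 9 / 4 * (F.L : ℝ) ^ 2 * ((10800 * (F.L : ℝ) + 1) * ε₀) := by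
    apply mul_le_mul hsq (mul_le_mul_of_nonneg_left hXε (by positivity)) (by positivity) (by positivity)
  have h2 : (F.L : ℝ) ^ 2 * ε₀ ≤ (F.L : ℝ) ^ 3 * ε₀ := mul_le_mul_of_nonneg_right (pow_le_pow_right₀ (by linarith) (by norm_num)) hε₀.le
  nlinarith [h1, h2, pow_nonneg hL0.le 3, hε₀.le]

/-- **THE `SU(2)` TWO-STAIRCASE LOOPS OF THE BACKGROUND TOWER ARE WITHIN `10⁻⁶` OF `1`**: for `U₀ ∈ 𝔘_k(ε₀)` (`10¹²L³ε₀ ≤ 1`), `j ≤ K − n`, every site `x` of `T^{(j)}`, every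
offset `r` and axis orders `σ, τ`: `dist1 (Ū₀ʲ(Γ_σ)·Ū₀ʲ(Γ_τ)⁻¹) ≤ 10⁻⁶` — the plaquette variables of the `j`-fold average `Ū₀ʲ` are within `(10800L+1)·L^{2j}·ε₀L^{−2(K−n)}` of `1`
(✓`plaqSmall_iter_T3_allL`) and the loop spans `≤ (3(L−1)∕2)²` of them (`dist1_holT_stair_mul_inv_stair_le`). [cite: Balaban1987RG1, (0.3)-(0.4) pp.252-253; Balaban1985Variational, (2) p.278, (146) p.301] -/
theorem dist1_stair_loop_iter_le_of_regPr {ε₀ : ℝ} (hε₀ : 0 < ε₀) (hWε : 10 ^ 12 * (F.L : ℝ) ^ 3 * ε₀ ≤ 1)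
    (U₀ : GaugeField (F.P K) 0 (Matrix.specialUnitaryGroup (Fin 2) ℂ)) (hreg : RegPr F n K ε₀ U₀) {j : ℕ} (hj : j ≤ K - n)
    (x : Site (F.P K) j) (σ τ : Equiv.Perm (Fin (F.P K).d)) (r : Fin (F.P K).d → Fin (F.P K).L) :
    dist1 (holT (Averaging.iter (fun l => blockAvg (P := F.P K) (j := l) T3UnitLawDensityEML.ℰp) j U₀) x (stairWord σ (off r)) *
        (holT (Averaging.iter (fun l => blockAvg (P := F.P K) (j := l) T3UnitLawDensityEML.ℰp) j U₀) x (stairWord τ (off r)))⁻¹) ≤ 1 / 10 ^ 6 := by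
  have hε7 : 10 ^ 7 * (F.L : ℝ) ^ 3 * ε₀ ≤ 1 := window7_of_window12 F hε₀ hWε
  have ht0 : 0 ≤ (10800 * (F.L : ℝ) + 1) * ((F.L : ℝ) ^ (2 * j) * regThreshold F n K ε₀) := by unfold regThreshold; positivity
  have hN : ∀ ν, (off r ν).natAbs ≤ ((F.P K).L - 1) / 2 := by
    intro ν
    have h := off_bounds r ν
    omega
  exact (dist1_holT_stair_mul_inv_stair_le ht0 _ (plaqSmall_iter_T3_allL F n K hε₀ hε7 U₀ hreg.plaqSmall j hj) x σ τ (off r) hN).trans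
    (loop_budget F hε₀ hWε hj)

/-- the twisted reading of a stair transport of the covariant tower: `D̄_j(Γ_{y,(r,σ)}) = τ_j(y,(r,σ,σ′))·Ū₀♭ʲ(Γ_{y,(r,σ)})` (✓`tstairU_def`). [cite: Balaban1985Averaging, (58) p.27] -/
theorem holT_dbar_eq_tstairU_mul {P : Params} {𝔸 : Type*} [NormedRing 𝔸] [NormedAlgebra ℂ 𝔸] [CompleteSpace 𝔸] {j : ℕ} (U₀ W : GaugeField P j 𝔸ˣ)
    (y : Site P (j + 1)) (r : Fin P.d → Fin P.L) (σ σ' : Equiv.Perm (Fin P.d)) :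
    holT W (emb y) (stairWord σ (off r)) = tstairU U₀ W y (r, σ, σ') * holT U₀ (emb y) (stairWord σ (off r)) := by
  rw [tstairU_def, inv_mul_cancel_right]

/-- ★ **T5's LOOP IS A CONJUGATED NEAR-IDENTITY TRIPLE** (★px11 g0's reading (G2), adopted by the namer ★w5-20520 g6): both staircases `Γ_i = Γ_{(r,σ)}`, `Γ_ref = Γ_{(r,1)}` of
`H_{j,y,i} = Q_{y,i}·Q_{y,(i.1,1,1)}⁻¹·Q_{y,(r_c,1,1)}` end at the same site, the centre factor is the empty word, and `D̄_j(Γ) = τ·Ū₀♭ʲ(Γ)`; hence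
`H_{j,y,i} = ν_j(ŷ)·(τ_j(y,i)·ι(Ū₀ʲ(Γ_i)Ū₀ʲ(Γ_ref)⁻¹)·τ_j(y,(i.1,1,1))⁻¹)·ν_j(ŷ)⁻¹` with `ι : SU(2) → (M₂)ˣ` and `Ū₀ʲ` the route's `SU(2)` tower (`U₀ ∈ 𝔘_k(ε₀)`, `10⁷L³ε₀ ≤ 1`,
✓`coe_iter_eq_emlIterU_of_regPr`) — the `U′`-tower's own plaquettes never enter. [cite: Balaban1985Averaging, (8)-(9) pp.18-19, (58) p.27, (97) p.32; Balaban1987RG1, (0.3) p.252, (0.11) p.253] -/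
theorem loopH_eq_conj_of_regPr {ε₀ : ℝ} (hε₀ : 0 < ε₀) (hε7 : 10 ^ 7 * (F.L : ℝ) ^ 3 * ε₀ ≤ 1)
    (U₀ U' : GaugeField (F.P K) 0 (Matrix.specialUnitaryGroup (Fin 2) ℂ)) (hreg : RegPr F n K ε₀ U₀) {j : ℕ} (hj : j ≤ K - n)
    (y : Site (F.P K) (j + 1)) (i : Idx (F.P K)) (hc : ((F.P K).L - 1) / 2 < (F.P K).L) :
    (frameAccU j (bgUnits F K U₀) (bgUnits F K U') (emb y) * holT (dbarCovIterU j (bgUnits F K U₀) (bgUnits F K U')) (emb y) (stairWord i.2.1 (off i.1)) *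
          (frameAccU j (bgUnits F K U₀) (bgUnits F K U') (transl (emb y) (disp (stairWord i.2.1 (off i.1)))))⁻¹) *
        (frameAccU j (bgUnits F K U₀) (bgUnits F K U') (emb y) * holT (dbarCovIterU j (bgUnits F K U₀) (bgUnits F K U')) (emb y) (stairWord (1 : Equiv.Perm (Fin (F.P K).d)) (off i.1)) *
          (frameAccU j (bgUnits F K U₀) (bgUnits F K U') (transl (emb y) (disp (stairWord (1 : Equiv.Perm (Fin (F.P K).d)) (off i.1)))))⁻¹)⁻¹ *
        (frameAccU j (bgUnits F K U₀) (bgUnits F K U') (emb y) *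
            holT (dbarCovIterU j (bgUnits F K U₀) (bgUnits F K U')) (emb y) (stairWord (1 : Equiv.Perm (Fin (F.P K).d)) (off (fun _ : Fin (F.P K).d => (⟨((F.P K).L - 1) / 2, hc⟩ : Fin (F.P K).L)))) *
          (frameAccU j (bgUnits F K U₀) (bgUnits F K U') (transl (emb y) (disp (stairWord (1 : Equiv.Perm (Fin (F.P K).d)) (off (fun _ : Fin (F.P K).d => (⟨((F.P K).L - 1) / 2, hc⟩ : Fin (F.P K).L)))))))⁻¹) =
      frameAccU j (bgUnits F K U₀) (bgUnits F K U') (emb y) *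
        (tstairU (emlIterU j (bgUnits F K U₀)) (dbarCovIterU j (bgUnits F K U₀) (bgUnits F K U')) y i *
          (Unitary.toUnits.comp (suIncl (N := 2)))
            (holT (Averaging.iter (fun l => blockAvg (P := F.P K) (j := l) T3UnitLawDensityEML.ℰp) j U₀) (emb y) (stairWord i.2.1 (off i.1)) *
              (holT (Averaging.iter (fun l => blockAvg (P := F.P K) (j := l) T3UnitLawDensityEML.ℰp) j U₀) (emb y) (stairWord (1 : Equiv.Perm (Fin (F.P K).d)) (off i.1)))⁻¹) *
          (tstairU (emlIterU j (bgUnits F K U₀)) (dbarCovIterU j (bgUnits F K U₀) (bgUnits F K U')) y (i.1, 1, 1))⁻¹) *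
        (frameAccU j (bgUnits F K U₀) (bgUnits F K U') (emb y))⁻¹ := by
  -- the `SU(2)` loop of the background tower, read in `(M₂)ˣ`
  have hg : holT (emlIterU j (bgUnits F K U₀)) (emb y) (stairWord i.2.1 (off i.1)) * (holT (emlIterU j (bgUnits F K U₀)) (emb y) (stairWord (1 : Equiv.Perm (Fin (F.P K).d)) (off i.1)))⁻¹ =
      (Unitary.toUnits.comp (suIncl (N := 2)))
        (holT (Averaging.iter (fun l => blockAvg (P := F.P K) (j := l) T3UnitLawDensityEML.ℰp) j U₀) (emb y) (stairWord i.2.1 (off i.1)) *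
          (holT (Averaging.iter (fun l => blockAvg (P := F.P K) (j := l) T3UnitLawDensityEML.ℰp) j U₀) (emb y) (stairWord (1 : Equiv.Perm (Fin (F.P K).d)) (off i.1)))⁻¹) := by
    rw [bgUnits_eq F K U₀, ← coe_iter_eq_emlIterU_of_regPr F n K hε₀ hε7 hreg hj, holT_unitsField_toUField_eq_map, holT_unitsField_toUField_eq_map, ← map_inv, ← map_mul]
  -- the centre factor is trivial, the two end frames coincide, the stair transports are twisted readings
  obtain ⟨r, σ, σ'⟩ := i
  rw [← hg, stairWord_off_centre, holT_nil, disp_nil, B10Eq27TorusAxialLog.transl_zero, mul_one, mul_inv_cancel, mul_one,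
    disp_stairWord_eq (1 : Equiv.Perm (Fin (F.P K).d)) σ (off r),
    holT_dbar_eq_tstairU_mul (emlIterU j (bgUnits F K U₀)) (dbarCovIterU j (bgUnits F K U₀) (bgUnits F K U')) y r σ σ',
    holT_dbar_eq_tstairU_mul (emlIterU j (bgUnits F K U₀)) (dbarCovIterU j (bgUnits F K U₀) (bgUnits F K U')) y r 1 1]
  simp only [mul_inv_rev, inv_inv, mul_assoc, inv_mul_cancel_left]

/-- ★★ **ROW `hH` FROM `RegPr`**: at `U₀ ∈ 𝔘_k(ε₀)` (`10¹²L³ε₀ ≤ 1`), chart point `U′ = e^{A₁}U₀` (`‖A₁‖ < e·η`, `10⁹L²e ≤ 1`), the gauge-invariant loop holonomies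
`H_{j,y,i} = Q_{y,i}Q_{y,(i.1,1,1)}⁻¹Q_{y,(r_c,1,1)}` of T5 are within `1∕200` of `1` at every level `j < K − n` — `H` is the conjugate by the special unitary frame `ν_j(ŷ)` of the triple
`τ_i·ι(g)·τ_ref⁻¹` (`loopH_eq_conj_of_regPr`) with `‖τ − 1‖ ≤ 10⁻⁶` (`norm_tstairU_sub_one_le_of_regPr`) and `|g − 1| ≤ 10⁻⁶` (`dist1_stair_loop_iter_le_of_regPr`), so
`‖H − 1‖ ≤ 4·10⁻⁶ + 2·10⁻⁶` (`norm_conj_triple_sub_one_le`).  NO regularity of `U′` is used (★px11 g0's (G2)).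
[cite: Balaban1985Averaging, (19)-(20) p.21, (58) p.27, (97) p.32; Balaban1987RG1, (0.3)-(0.4) pp.252-253; Balaban1985Variational, (2) p.278, (146) p.301] -/
theorem norm_loopH_sub_one_le_of_regPr {ε₀ e : ℝ} (hε₀ : 0 < ε₀) (he : 0 < e) (hWe : 10 ^ 9 * (F.L : ℝ) ^ 2 * e ≤ 1) (hWε : 10 ^ 12 * (F.L : ℝ) ^ 3 * ε₀ ≤ 1)
    (U₀ U' : GaugeField (F.P K) 0 (Matrix.specialUnitaryGroup (Fin 2) ℂ)) (hreg : RegPr F n K ε₀ U₀)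
    (A₁ : PBond (F.P K) 0 → Matrix (Fin 2) (Fin 2) ℂ) (hA₁ : ‖A₁‖ < e * eta F n K)
    (hU' : ∀ b, ((U' b : Matrix.specialUnitaryGroup (Fin 2) ℂ) : Matrix (Fin 2) (Fin 2) ℂ) = exp (A₁ b) * ((U₀ b : Matrix.specialUnitaryGroup (Fin 2) ℂ) : Matrix (Fin 2) (Fin 2) ℂ)) :
    ∀ (j : ℕ) (y : Site (F.P K) (j + 1)) (i : Idx (F.P K)), j < K - n → ‖((((frameAccU j (bgUnits F K U₀) (bgUnits F K U') (emb y) * holT (dbarCovIterU j (bgUnits F K U₀) (bgUnits F K U')) (emb y) (stairWord i.2.1 (off i.1)) * (frameAccU j (bgUnits F K U₀) (bgUnits F K U') (transl (emb y) (disp (stairWord i.2.1 (off i.1)))))⁻¹) * (frameAccU j (bgUnits F K U₀) (bgUnits F K U') (emb y) * holT (dbarCovIterU j (bgUnits F K U₀) (bgUnits F K U')) (emb y) (stairWord (1 : Equiv.Perm (Fin (F.P K).d)) (off i.1)) * (frameAccU j (bgUnits F K U₀) (bgUnits F K U') (transl (emb y) (disp (stairWord (1 : Equiv.Perm (Fin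 (F.P K).d)) (off i.1)))))⁻¹)⁻¹ * (frameAccU j (bgUnits F K U₀) (bgUnits F K U') (emb y) * holT (dbarCovIterU j (bgUnits F K U₀) (bgUnits F K U')) (emb y) (stairWord (1 : Equiv.Perm (Fin (F.P K).d)) (off (fun _ : Fin (F.P K).d => (⟨((F.P K).L - 1) / 2, by have := (F.P K).L_pos; omega⟩ : Fin (F.P K).L)))) * (frameAccU j (bgUnits F K U₀) (bgUnits F K U') (transl (emb y) (disp (stairWord (1 : Equiv.Perm (Fin (F.P K).d)) (off (fun _ : Fin (F.P K).d => (⟨((F.P K).L - 1) / 2, by have := (F.P K).L_pos; omega⟩ : Fin (F.P K).L)))))))⁻¹)) : (Matrix (Fin 2) (Fin 2) ℂ)ˣ) : Matrix (Fin 2) (Fin 2) ℂ) - 1‖ ≤ 1 / 200 := by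
  intro j y i hj
  have hε7 : 10 ^ 7 * (F.L : ℝ) ^ 3 * ε₀ ≤ 1 := window7_of_window12 F hε₀ hWε
  rw [loopH_eq_conj_of_regPr F hε₀ hε7 U₀ U' hreg hj.le y i]
  have hν : frameAccU j (bgUnits F K U₀) (bgUnits F K U') (emb y) ∈ U1 (Matrix (Fin 2) (Fin 2) ℂ) :=
    specialUnitaryUnits_le_U1 (by rw [mem_specialUnitaryUnits]; exact frameAccU_bgUnits_mem_specialUnitaryGroup_of_regPr F hε₀ he hWe hWε U₀ U' hreg A₁ hA₁ hU' hj.le (emb y))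
  have hG : (Unitary.toUnits.comp (suIncl (N := 2)))
        (holT (Averaging.iter (fun l => blockAvg (P := F.P K) (j := l) T3UnitLawDensityEML.ℰp) j U₀) (emb y) (stairWord i.2.1 (off i.1)) *
          (holT (Averaging.iter (fun l => blockAvg (P := F.P K) (j := l) T3UnitLawDensityEML.ℰp) j U₀) (emb y) (stairWord (1 : Equiv.Perm (Fin (F.P K).d)) (off i.1)))⁻¹) ∈
      U1 (Matrix (Fin 2) (Fin 2) ℂ) :=
    specialUnitaryUnits_le_U1 (by rw [mem_specialUnitaryUnits, coe_map_eq]; exact SetLike.coe_mem _)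
  have hGd : ‖(((Unitary.toUnits.comp (suIncl (N := 2)))
        (holT (Averaging.iter (fun l => blockAvg (P := F.P K) (j := l) T3UnitLawDensityEML.ℰp) j U₀) (emb y) (stairWord i.2.1 (off i.1)) *
          (holT (Averaging.iter (fun l => blockAvg (P := F.P K) (j := l) T3UnitLawDensityEML.ℰp) j U₀) (emb y) (stairWord (1 : Equiv.Perm (Fin (F.P K).d)) (off i.1)))⁻¹) :
        (Matrix (Fin 2) (Fin 2) ℂ)ˣ) : Matrix (Fin 2) (Fin 2) ℂ) - 1‖ ≤ 1 / 10 ^ 6 := by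
    rw [coe_map_eq, ← dist1_SU_eq]
    exact dist1_stair_loop_iter_le_of_regPr F hε₀ hWε U₀ hreg hj.le (emb y) i.2.1 1 i.1
  have hτ := norm_tstairU_sub_one_le_of_regPr F hε₀ he hWe hWε U₀ U' hreg A₁ hA₁ hU' hj y i
  have hτ' := norm_tstairU_sub_one_le_of_regPr F hε₀ he hWe hWε U₀ U' hreg A₁ hA₁ hU' hj y (i.1, 1, 1)
  exact (norm_conj_triple_sub_one_le hν hG hτ hτ' (by norm_num) hGd).trans (by norm_num)

/-- ★★ **ROW `hH'` FROM `RegPr`**: the inverse loops `H_{j,y,i}⁻¹ = ν_j(ŷ)·(τ_ref·ι(g)⁻¹·τ_i⁻¹)·ν_j(ŷ)⁻¹` are within `1∕200` of `1` as well (`|g⁻¹ − 1| = |g − 1|` on `SU(2)`).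
[cite: Balaban1985Averaging, (19)-(20) p.21, (58) p.27; Balaban1987RG1, (0.3)-(0.4) pp.252-253; Balaban1985Variational, (2) p.278, (146) p.301] -/
theorem norm_loopH_inv_sub_one_le_of_regPr {ε₀ e : ℝ} (hε₀ : 0 < ε₀) (he : 0 < e) (hWe : 10 ^ 9 * (F.L : ℝ) ^ 2 * e ≤ 1) (hWε : 10 ^ 12 * (F.L : ℝ) ^ 3 * ε₀ ≤ 1)
    (U₀ U' : GaugeField (F.P K) 0 (Matrix.specialUnitaryGroup (Fin 2) ℂ)) (hreg : RegPr F n K ε₀ U₀)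
    (A₁ : PBond (F.P K) 0 → Matrix (Fin 2) (Fin 2) ℂ) (hA₁ : ‖A₁‖ < e * eta F n K)
    (hU' : ∀ b, ((U' b : Matrix.specialUnitaryGroup (Fin 2) ℂ) : Matrix (Fin 2) (Fin 2) ℂ) = exp (A₁ b) * ((U₀ b : Matrix.specialUnitaryGroup (Fin 2) ℂ) : Matrix (Fin 2) (Fin 2) ℂ)) :
    ∀ (j : ℕ) (y : Site (F.P K) (j + 1)) (i : Idx (F.P K)), j < K - n → ‖((((frameAccU j (bgUnits F K U₀) (bgUnits F K U') (emb y) * holT (dbarCovIterU j (bgUnits F K U₀) (bgUnits F K U')) (emb y) (stairWord i.2.1 (off i.1)) * (frameAccU j (bgUnits F K U₀) (bgUnits F K U') (transl (emb y) (disp (stairWord i.2.1 (off i.1)))))⁻¹) * (frameAccU j (bgUnits F K U₀) (bgUnits F K U') (emb y) * holT (dbarCovIterU j (bgUnits F K U₀) (bgUnits F K U')) (emb y) (stairWord (1 : Equiv.Perm (Fin (F.P K).d)) (off i.1)) * (frameAccU j (bgUnits F K U₀) (bgUnits F K U') (transl (emb y) (disp (stairWord (1 : Equiv.Perm (Fin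 (F.P K).d)) (off i.1)))))⁻¹)⁻¹ * (frameAccU j (bgUnits F K U₀) (bgUnits F K U') (emb y) * holT (dbarCovIterU j (bgUnits F K U₀) (bgUnits F K U')) (emb y) (stairWord (1 : Equiv.Perm (Fin (F.P K).d)) (off (fun _ : Fin (F.P K).d => (⟨((F.P K).L - 1) / 2, by have := (F.P K).L_pos; omega⟩ : Fin (F.P K).L)))) * (frameAccU j (bgUnits F K U₀) (bgUnits F K U') (transl (emb y) (disp (stairWord (1 : Equiv.Perm (Fin (F.P K).d)) (off (fun _ : Fin (F.P K).d => (⟨((F.P K).L - 1) / 2, by have := (F.P K).L_pos; omega⟩ : Fin (F.P K).L)))))))⁻¹))⁻¹ : (Matrix (Fin 2) (Fin 2) ℂ)ˣ) : Matrix (Fin 2) (Fin 2) ℂ) - 1‖ ≤ 1 / 200 := by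
  intro j y i hj
  have hε7 : 10 ^ 7 * (F.L : ℝ) ^ 3 * ε₀ ≤ 1 := window7_of_window12 F hε₀ hWε
  rw [loopH_eq_conj_of_regPr F hε₀ hε7 U₀ U' hreg hj.le y i]
  -- the inverse of the conjugated triple is the conjugated reversed triple
  rw [show ∀ (ν τ G τ' : (Matrix (Fin 2) (Fin 2) ℂ)ˣ), (ν * (τ * G * τ'⁻¹) * ν⁻¹)⁻¹ = ν * (τ' * G⁻¹ * τ⁻¹) * ν⁻¹ from fun ν τ G τ' => by
    simp only [mul_inv_rev, inv_inv, mul_assoc], ← map_inv]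
  have hν : frameAccU j (bgUnits F K U₀) (bgUnits F K U') (emb y) ∈ U1 (Matrix (Fin 2) (Fin 2) ℂ) :=
    specialUnitaryUnits_le_U1 (by rw [mem_specialUnitaryUnits]; exact frameAccU_bgUnits_mem_specialUnitaryGroup_of_regPr F hε₀ he hWe hWε U₀ U' hreg A₁ hA₁ hU' hj.le (emb y))
  have hG : (Unitary.toUnits.comp (suIncl (N := 2)))
        (holT (Averaging.iter (fun l => blockAvg (P := F.P K) (j := l) T3UnitLawDensityEML.ℰp) j U₀) (emb y) (stairWord i.2.1 (off i.1)) *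
          (holT (Averaging.iter (fun l => blockAvg (P := F.P K) (j := l) T3UnitLawDensityEML.ℰp) j U₀) (emb y) (stairWord (1 : Equiv.Perm (Fin (F.P K).d)) (off i.1)))⁻¹)⁻¹ ∈
      U1 (Matrix (Fin 2) (Fin 2) ℂ) :=
    specialUnitaryUnits_le_U1 (by rw [mem_specialUnitaryUnits, coe_map_eq]; exact SetLike.coe_mem _)
  have hGd : ‖(((Unitary.toUnits.comp (suIncl (N := 2)))
        (holT (Averaging.iter (fun l => blockAvg (P := F.P K) (j := l) T3UnitLawDensityEML.ℰp) j U₀) (emb y) (stairWord i.2.1 (off i.1)) *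
          (holT (Averaging.iter (fun l => blockAvg (P := F.P K) (j := l) T3UnitLawDensityEML.ℰp) j U₀) (emb y) (stairWord (1 : Equiv.Perm (Fin (F.P K).d)) (off i.1)))⁻¹)⁻¹ :
        (Matrix (Fin 2) (Fin 2) ℂ)ˣ) : Matrix (Fin 2) (Fin 2) ℂ) - 1‖ ≤ 1 / 10 ^ 6 := by
    rw [coe_map_eq, ← dist1_SU_eq, GaugeGroup.dist1_inv]
    exact dist1_stair_loop_iter_le_of_regPr F hε₀ hWε U₀ hreg hj.le (emb y) i.2.1 1 i.1
  have hτ := norm_tstairU_sub_one_le_of_regPr F hε₀ he hWe hWε U₀ U' hreg A₁ hA₁ hU' hj y i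
  have hτ' := norm_tstairU_sub_one_le_of_regPr F hε₀ he hWe hWε U₀ U' hreg A₁ hA₁ hU' hj y (i.1, 1, 1)
  exact (norm_conj_triple_sub_one_le hν hG hτ' hτ (by norm_num) hGd).trans (by norm_num)

end T3

end Summit.QuantumFields.YangMills.Theorems.Prop7TowerClosenessOfRegPr

end
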